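import Literature.MathematicalPhysics.QuantumFieldTheory.BalabanImbrieJaffe1984to88.BIJ88NeumannRandomWalkTorus
import Literature.MathematicalPhysics.QuantumFieldTheory.BalabanImbrieJaffe1984to88.BIJ85BlockAveragingIneq

/-!
# `BalabanImbrieJaffe1984to88.BIJ88NeumannCommutator210Torus` — [6] (2.4), (2.5), (2.8), (2.10): the three-term form of the commutator `K_i = [h_i, H_{Q_i}(u)]` on the BIJ torus

T. Bałaban, *Regularity and decay of lattice Green's functions*, Comm. Math. Phys. **89** (1983) 571–597 (= [6] of
Bałaban–Imbrie–Jaffe, *CMP* **114** (1988), cited there before (2.65) p. 270 for the random-walk expansion of the Neumann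
propagators `G_k(Ω, u)`), §2 pp. 575–576.

## What this file proves (pure algebra — EVERY `U(1)` field, every real cut-off, every region; no smallness anywhere)

Gen 25's `BIJ88NeumannRandomWalkTorus` set up the random-walk expansion (2.12)/(2.13) of [6] on the torus of record
`Balaban1983to89.Site P j` with the letters `K_i := h_iH_{Q_i}(u) − H_{Q_i}(u)h_i` (`kLet`) left as a COMMUTATOR, recording only its
kernel `K_i(x,y) = (h_i(x) − h_i(y))H_{Q_i}(u)(x,y)` (`kLet_apply`); the printed three-term form (2.10) — gradient term, Laplacian term,
block term — was *"not re-derived"* there.  This file derives it, for the Neumann operator of record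
`H_Q(u) = (χ_QD_u)ᴴ(χ_QD_u) + a·(Q_k|_Q)ᴴ(Q_k|_Q)` (`nOp a c U k Q`, `nOp_eq`):

* **(2.4)** `dN_conjTranspose_mulVec` — the adjoint of the Neumann-cut covariant derivative, entrywise:
  `((χ_ΩD_u)ᴴg)(x) = Σ_μ ( c·conj(u_{⟨x−e_μ,x⟩})[⟨x−e_μ,x⟩ ⊂ Ω]g(⟨x−e_μ,x⟩) − c[⟨x,x+e_μ⟩ ⊂ Ω]g(⟨x,x+e_μ⟩) )`;
* **(2.5)** `gram_dN_mulVec_mulR` — the Leibniz rule of the Neumann Laplacian against a real cut-off: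
  `(−Δ^N_{u,Q}(hφ))(x) = h(x)(−Δ^N_{u,Q}φ)(x) − Σ_{b∈st(x),b⊂Q}(∂^ηh)(b)(D^η_uφ)(b) − (Δ^{η,N}_Qh)(x)φ(x)` (uses only `|u_b| = 1`);
* **(2.8)** `qMatK_conjTranspose_mulVec`, `qMatK_mulVec_eq_sum`, `gram_qMatK_mulVec`, `gram_qMatK_comm_mulR` — the block average
  and its Gram operator entrywise, and the block Leibniz rule `a(h·(QᴴQφ) − QᴴQ(hφ)) = −blockTerm`;
* **(2.10)** `kLet_mulVec` — **`(K_iφ)(x) = gradTerm + (Δ^{η,N}_{Q_i}h_i)(x)·φ(x) − blockTerm`**, with the three terms as explicit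
  definitions `gradTerm` (`Σ_{b∈st(x),b⊂Q}(∂^ηh)(b)(D^η_uφ)(b)`, the `2d` bonds at `x` oriented away from `x`), `lapNh`
  (`(Δ^{η,N}_Qh)(x) = c²Σ_{b∈st(x),b⊂Q}(h(other end of b) − h(x))`) and `blockTerm`
  (`a·L^{−2kd}·conj(u(Γ_{x_k,x}))·Σ_{x′∈B^k(x_k)}u(Γ_{x_k,x′})(h(x′) − h(x))φ(x′)`, the `R_k(A, ∂^ηh)` of (2.8) composed with `(Q_k|_Q)ᴴ`);
  the printed indicator `1_{□_j}(x)` is automatic (`kLet_mulVec_eq_zero_of_not_mem`);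
* **§5, the inputs of "R is a small operator … because |∂^ηh_j| ≦ O(M⁻¹), |Δ^ηh_j| ≦ O(M⁻²)" (p. 577 l. 1–2)**: first-order bounds
  `norm_gradTerm_le`, `abs_lapNh_le`, `norm_blockTerm_le` (by `|u_b| = |u(Γ)| = 1`), the interior second-difference form
  `lapNh_eq_of_forall_mem`, the one-sided face form `lapNh_dir_of_mem_of_not_mem` (the boundary term of (2.6)–(2.7)), and the support
  statement `kLet_mulVec_eq_zero_of_forall_eq` (`K_i` lives where `h_i` varies).

Sign convention: [6] defines `K_j` through (2.9) `(−Δ^N + a_kP_k)G₀ = I − Σ_jK_jG_k(□_j,A_j)h_j`, i.e. `K_j = h_jH − Hh_j` — exactly gen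
25's `kLet`; (2.10) as printed, *"(K_jφ)(x) = 1_{□_j}(x)[Σ_{b∈st(x)}(∂^ηh_j)(b)(D^η_{Ã_j}φ)(b) + (Δ^ηh_j)(x)φ(x) − Σ_{x′∈B^k(y^k(x))}
η^d(∂^ηh_j)(Γ^{(k)}_{x,y^k(x),x′})U(Ã_j(Γ^{(k)}_{x,y^k(x),x′}))φ(x′)]"*, is `kLet_mulVec` with `(∂^ηh)(Γ_{x,y,x′})`, the sum of
`η(∂^ηh)` along the contour, telescoped to `h(x′) − h(x)`.  `c = η⁻¹` is the inverse lattice spacing of `D^η_u` (`covD c`), `a` the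
averaging weight, both arbitrary reals here.

Carrier and vocabulary BY NAME: the torus `Balaban1983to89.Site P j`, bonds `PBond P j` (`⟨x, μ⟩ = ⟨x, x+e_μ⟩`, `.src`/`.tgt`),
`x.shift μ`/`x.unshift μ`; p13/p22/p35-era `BIJ88Sect3Statements` (`cfg`, `covD`, `starB`), `BIJ88NeumannPropagator227Torus`
(`dN`, `qMatK`, `nOp`, `nOp_eq`), `BIJ85BlockAveragesTorusK` (`blockK`, `blkIter`, `holCK`, `norm_holCK`), gen 25
`BIJ88NeumannRandomWalkTorus` (`mulR`, `mulR_mulVec`, `dN_mulVec_mulR`, `kLet`), `BIJ85BlockAveragingIneq.sum_bond_eq`.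
Nothing is re-declared; no `def … : Prop`; no hypothesis on the field.

statement-level skeleton of published theorems with citation tags; proofs where landed; nothing here is a claim about the Yang–Mills mass gap

## References
* [Balaban1983RegularityDecay] T. Bałaban, Regularity and decay of lattice Green's functions, Comm. Math. Phys. 89 (1983) 571–597, §2 (2.3)–(2.11) pp. 575–577.
* [BalabanImbrieJaffe1988] T. Bałaban, J. Imbrie, A. Jaffe, Effective action and cluster properties of the abelian Higgs model,
  Comm. Math. Phys. 114 (1988) 257–315, (1.1) p. 258, (2.27) p. 263, before (2.65) p. 270.
-/

open scoped BigOperators Matrix ComplexConjugate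
open Finset Matrix

namespace Literature.MathematicalPhysics.QuantumFieldTheory.BalabanImbrieJaffe1984to88.BIJ88NeumannCommutator210Torus

open Literature.MathematicalPhysics.QuantumFieldTheory.Balaban1983to89
open BIJ88Sect3Statements (U1 toC cfg covD starB mem_starB norm_toC)
open BIJ85BlockAveragesTorus BIJ85BlockAveragesTorusK
open BIJ85BlockAveragingIneq (sum_bond_eq)
open BIJ88Vj5610Operator (dMat chiN)
open BIJ88NeumannNoZeroModesTorus BIJ88NeumannPropagator227Torus
open BIJ88NeumannRandomWalkTorus

noncomputable section

variable {P : Params} {j : ℕ}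

/-! ## §0 Torus bookkeeping -/

section Torus

/-- `x + e_μ ≠ x` on every torus of the series (`|T^{(j)}| ≥ 2`). [folklore] -/
private theorem shift_ne_self (x : Balaban1983to89.Site P j) (μ : Fin P.d) : x.shift μ ≠ x := by
  intro h
  have h1 := congrFun h μ
  simp only [Balaban1983to89.Site.shift, Function.update_self] at h1
  exact one_ne_zero (add_eq_left.1 h1)

/-- `(x + e_μ) − e_μ = x`. [folklore] -/
private theorem unshift_shift (x : Balaban1983to89.Site P j) (μ : Fin P.d) : (x.shift μ).unshift μ = x :=
  (LatticeFieldCalculus.shiftEquiv (P := P) (j := j) μ).symm_apply_apply x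

/-- `(x − e_μ) + e_μ = x`. [folklore] -/
private theorem shift_unshift (x : Balaban1983to89.Site P j) (μ : Fin P.d) : (x.unshift μ).shift μ = x :=
  (LatticeFieldCalculus.shiftEquiv (P := P) (j := j) μ).apply_symm_apply x

/-- `y + e_μ = x ↔ y = x − e_μ`. [folklore] -/
private theorem shift_eq_iff {x y : Balaban1983to89.Site P j} {μ : Fin P.d} : y.shift μ = x ↔ y = x.unshift μ := by
  constructor
  · rintro rfl; exact (unshift_shift y μ).symm
  · rintro rfl; exact shift_unshift x μ

/-- `|u_b|² = 1` in the form `conj(u_b)·u_b = 1`. [cite: BalabanImbrieJaffe1988, (1.1) p.258] -/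
private theorem conj_cfg_mul_cfg (U : GaugeField P j U1) (b : PBond P j) : (starRingEnd ℂ) (cfg U b) * cfg U b = 1 := by
  rw [← Complex.normSq_eq_conj_mul_self, Complex.normSq_eq_norm_sq]
  unfold cfg
  rw [norm_toC]; norm_num

end Torus

/-! ## §1 The adjoint of the Neumann-cut covariant derivative and the blocks of `Q_k|_Ωᴴ`, entrywise -/

section Adjoint

/-- kernel: the conjugated entry of `χ_ΩD_u`: `conj((χ_ΩD_u)(b,x)) = [b ⊂ Ω]·(c·conj(u_b)·[x = b₊] − c·[x = b₋])`.
[cite: Balaban1983RegularityDecay, (2.4) p.575] -/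
theorem conj_dN_apply (c : ℝ) (U : GaugeField P j U1) (Ω : Finset (Balaban1983to89.Site P j)) (b : PBond P j) (x : Balaban1983to89.Site P j) :
    (starRingEnd ℂ) (dN c U Ω b x)
      = if b ∈ starB Ω then (c : ℂ) * (if x = b.tgt then (starRingEnd ℂ) (cfg U b) else 0) - (c : ℂ) * (if x = b.src then 1 else 0)
        else 0 := by
  rw [dN_apply]
  unfold dMat
  rw [Matrix.of_apply]
  split_ifs <;> simp

/-- **THE ADJOINT DERIVATIVE OF (2.4) ON THE TORUS, Neumann-cut**: for a bond function `g`,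
`((χ_ΩD_u)ᴴg)(x) = Σ_μ ( c·conj(u_{⟨x−e_μ,x⟩})·[⟨x−e_μ,x⟩ ⊂ Ω]·g(⟨x−e_μ,x⟩) − c·[⟨x,x+e_μ⟩ ⊂ Ω]·g(⟨x,x+e_μ⟩) )` — the operator
`D^{η*}_A` of the printed (2.4) (which is the PRODUCT RULE for `D^{η*}_A(gθ)`; this is its `θ ≡ 1` case), with the bonds of `Ω` only.
[cite: Balaban1983RegularityDecay, (2.4) p.575] -/
theorem dN_conjTranspose_mulVec (c : ℝ) (U : GaugeField P j U1) (Ω : Finset (Balaban1983to89.Site P j)) (g : PBond P j → ℂ)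
    (x : Balaban1983to89.Site P j) :
    ((dN c U Ω)ᴴ *ᵥ g) x
      = ∑ μ : Fin P.d, ((if (⟨x.unshift μ, μ⟩ : PBond P j) ∈ starB Ω
            then (c : ℂ) * (starRingEnd ℂ) (cfg U ⟨x.unshift μ, μ⟩) * g ⟨x.unshift μ, μ⟩ else 0)
          - (if (⟨x, μ⟩ : PBond P j) ∈ starB Ω then (c : ℂ) * g ⟨x, μ⟩ else 0)) := by
  classical
  simp only [mulVec, dotProduct, conjTranspose_apply]
  have e1 : ∀ b : PBond P j, star (dN c U Ω b x) * g b
      = ((if b ∈ starB Ω then if x = b.tgt then (c : ℂ) * (starRingEnd ℂ) (cfg U b) * g b else 0 else 0)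
        - (if b ∈ starB Ω then if x = b.src then (c : ℂ) * g b else 0 else 0)) := by
    intro b
    rw [show star (dN c U Ω b x) = (starRingEnd ℂ) (dN c U Ω b x) from rfl, conj_dN_apply]
    split_ifs <;> ring
  rw [Finset.sum_congr rfl fun b _ => e1 b, sum_bond_eq, Finset.sum_comm]
  refine Finset.sum_congr rfl fun μ _ => ?_
  rw [Finset.sum_sub_distrib]
  congr 1
  · rw [Finset.sum_eq_single (x.unshift μ)]
    · have ht : x = (⟨x.unshift μ, μ⟩ : PBond P j).tgt := (shift_unshift x μ).symm
      rw [if_pos ht]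
    · intro y _ hy
      have ht : x ≠ (⟨y, μ⟩ : PBond P j).tgt := fun h => hy (shift_eq_iff.1 h.symm)
      rw [if_neg ht, ite_self]
    · intro h; exact absurd (Finset.mem_univ _) h
  · rw [Finset.sum_eq_single x]
    · rw [if_pos rfl]
    · intro y _ hy
      have hs : x ≠ (⟨y, μ⟩ : PBond P j).src := fun h => hy h.symm
      rw [if_neg hs, ite_self]
    · intro h; exact absurd (Finset.mem_univ _) h

/-- kernel: `((Q_k|_Ω)ᴴ g)(x) = [B^k(x_k) ⊆ Ω]·L^{−kd}·conj(u(Γ^{(k)}_{x_k,x}))·g(x_k)` — one block per fine site.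
[cite: Balaban1983RegularityDecay, (2.8) p.576] -/
theorem qMatK_conjTranspose_mulVec (U : GaugeField P j U1) (k : ℕ) (Ω : Finset (Balaban1983to89.Site P j))
    (g : Balaban1983to89.Site P (j+k) → ℂ) (x : Balaban1983to89.Site P j) :
    ((qMatK U k Ω)ᴴ *ᵥ g) x
      = if blockK k (blkIter k x) ⊆ Ω then ((P.L : ℂ) ^ (k * P.d))⁻¹ * (starRingEnd ℂ) (holCK U k x) * g (blkIter k x) else 0 := by
  classical
  simp only [mulVec, dotProduct, conjTranspose_apply]
  rw [Finset.sum_eq_single (blkIter k x)]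
  · rw [show star (qMatK U k Ω (blkIter k x) x) = (starRingEnd ℂ) (qMatK U k Ω (blkIter k x) x) from rfl, qMatK_apply]
    simp only [mem_blockK_blkIter, and_true]
    split_ifs with h
    · rw [map_mul, map_inv₀, map_pow, Complex.conj_natCast]
    · rw [map_zero, zero_mul]
  · intro y _ hy
    rw [show star (qMatK U k Ω y x) = (starRingEnd ℂ) (qMatK U k Ω y x) from rfl, qMatK_apply]
    have hx : ¬ (blockK k y ⊆ Ω ∧ x ∈ blockK k y) := fun h => hy (mem_blockK.1 h.2).symm
    rw [if_neg hx, map_zero, zero_mul]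
  · intro h; exact absurd (Finset.mem_univ _) h

/-- kernel: `((Q_k|_Ω)ψ)(y) = [B^k(y) ⊆ Ω]·L^{−kd}·Σ_{x′∈B^k(y)} u(Γ^{(k)}_{y,x′})ψ(x′)`. [cite: Balaban1983RegularityDecay, (2.8) p.576] -/
theorem qMatK_mulVec_eq_sum (U : GaugeField P j U1) (k : ℕ) (Ω : Finset (Balaban1983to89.Site P j))
    (ψ : Balaban1983to89.Site P j → ℂ) (y : Balaban1983to89.Site P (j+k)) :
    (qMatK U k Ω *ᵥ ψ) y
      = if blockK k y ⊆ Ω then ((P.L : ℂ) ^ (k * P.d))⁻¹ * ∑ x' ∈ blockK k y, holCK U k x' * ψ x' else 0 := by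
  classical
  simp only [mulVec, dotProduct, qMatK_apply]
  by_cases hΩ : blockK k y ⊆ Ω
  · simp only [hΩ, true_and, if_true]
    simp_rw [ite_mul, zero_mul]
    rw [Finset.sum_ite_mem, Finset.univ_inter, Finset.mul_sum]
    exact Finset.sum_congr rfl fun x _ => mul_assoc _ _ _
  · simp only [hΩ, false_and, if_false, zero_mul, Finset.sum_const_zero]

end Adjoint

/-! ## §2 The three terms of (2.10) on the torus -/

section Terms

variable (c : ℝ) (U : GaugeField P j U1) (Q : Finset (Balaban1983to89.Site P j)) (h : Balaban1983to89.Site P j → ℝ)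

/-- **THE GRADIENT TERM of (2.10)** at `x`: `Σ_{b∈st(x), b⊂Q} (∂^ηh)(b)(D^η_uφ)(b)` over the `2d` bonds at `x` inside `Q`, the bonds
oriented AWAY from `x` — forward bonds `⟨x, x+e_μ⟩` with `(∂h)(b) = c(h(x+e_μ) − h(x))`, backward bonds `b̄` of `b = ⟨x−e_μ, x⟩` with
`(∂h)(b̄) = c(h(x−e_μ) − h(x))` and `(D_uφ)(b̄) = −conj(u_b)(D_uφ)(b)` (`|u_b| = 1`). [cite: Balaban1983RegularityDecay, (2.10) p.576] -/
def gradTerm (φ : Balaban1983to89.Site P j → ℂ) (x : Balaban1983to89.Site P j) : ℂ :=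
  ∑ μ : Fin P.d, ((if (⟨x, μ⟩ : PBond P j) ∈ starB Q then (c : ℂ) * ((h (x.shift μ) : ℂ) - h x) * covD c (cfg U) φ ⟨x, μ⟩ else 0)
    + (if (⟨x.unshift μ, μ⟩ : PBond P j) ∈ starB Q
        then (c : ℂ) * ((h (x.unshift μ) : ℂ) - h x) * (-(starRingEnd ℂ) (cfg U ⟨x.unshift μ, μ⟩) * covD c (cfg U) φ ⟨x.unshift μ, μ⟩) else 0))

/-- **THE LAPLACIAN TERM of (2.10)**: `(Δ^{η,N}_Q h)(x) = c² Σ_{y ~ x, ⟨x,y⟩ ⊂ Q} (h(y) − h(x))` (the Neumann lattice Laplacian of the real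
cut-off, bonds of `Q` only; `c = η^{−1}`). [cite: Balaban1983RegularityDecay, (2.10) p.576] -/
def lapNh (x : Balaban1983to89.Site P j) : ℝ :=
  c ^ 2 * ∑ μ : Fin P.d, ((if (⟨x, μ⟩ : PBond P j) ∈ starB Q then h (x.shift μ) - h x else 0)
    + (if (⟨x.unshift μ, μ⟩ : PBond P j) ∈ starB Q then h (x.unshift μ) - h x else 0))

/-- **THE BLOCK TERM of (2.10)** (from (2.8) `R_k(A, ∂^ηh)`): `a·[B^k(x_k) ⊆ Q]·L^{−2kd}·conj(u(Γ^{(k)}_{x_k,x}))·Σ_{x′∈B^k(x_k)}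
u(Γ^{(k)}_{x_k,x′})(h(x′) − h(x))φ(x′)` — the printed *"Σ_{x′∈B^k(y^k(x))} η^d(∂^ηh_j)(Γ^{(k)}_{x,y^k(x),x′})U(Ã_j(Γ^{(k)}_{x,y^k(x),x′}))φ(x′)"*
with `(∂h)(Γ_{x,y,x′})` summed along the contour `= h(x′) − h(x)` and the transport from `x′` to `x` through `y = x_k`.
[cite: Balaban1983RegularityDecay, (2.8) p.576] -/
def blockTerm (a : ℝ) (k : ℕ) (φ : Balaban1983to89.Site P j → ℂ) (x : Balaban1983to89.Site P j) : ℂ :=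
  if blockK k (blkIter k x) ⊆ Q then
    (a : ℂ) * (((P.L : ℂ) ^ (k * P.d))⁻¹ * ((P.L : ℂ) ^ (k * P.d))⁻¹) * (starRingEnd ℂ) (holCK U k x)
      * ∑ x' ∈ blockK k (blkIter k x), holCK U k x' * (((h x' : ℂ) - h x) * φ x')
  else 0

end Terms

/-! ## §3 (2.5): the Neumann Laplacian of a product -/

section Leibniz

variable {k : ℕ}

/-- kernel: the Laplacian term read in `ℂ`. [cite: Balaban1983RegularityDecay, (2.10) p.576] -/
theorem lapNh_cast (c : ℝ) (Q : Finset (Balaban1983to89.Site P j)) (h : Balaban1983to89.Site P j → ℝ) (x : Balaban1983to89.Site P j) :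
    ((lapNh c Q h x : ℝ) : ℂ)
      = (c : ℂ) ^ 2 * ∑ μ : Fin P.d, ((if (⟨x, μ⟩ : PBond P j) ∈ starB Q then ((h (x.shift μ) : ℂ) - h x) else 0)
          + (if (⟨x.unshift μ, μ⟩ : PBond P j) ∈ starB Q then ((h (x.unshift μ) : ℂ) - h x) else 0)) := by
  unfold lapNh
  push_cast
  congr 1
  refine Finset.sum_congr rfl fun μ _ => ?_
  split_ifs <;> push_cast <;> ring

/-- kernel: the direction-`μ` piece of (2.5) — the two bonds `⟨x, x+e_μ⟩`, `⟨x−e_μ, x⟩` at `x`, with `|u_b| = 1` on the backward bond.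
[cite: Balaban1983RegularityDecay, (2.5) p.576] -/
private theorem dir_identity (c : ℝ) (U : GaugeField P j U1) (Q : Finset (Balaban1983to89.Site P j)) (h : Balaban1983to89.Site P j → ℝ)
    (φ : Balaban1983to89.Site P j → ℂ) (x : Balaban1983to89.Site P j) (μ : Fin P.d) :
    ((if (⟨x.unshift μ, μ⟩ : PBond P j) ∈ starB Q then
          (c : ℂ) * (starRingEnd ℂ) (cfg U ⟨x.unshift μ, μ⟩) * (dN c U Q *ᵥ (mulR h *ᵥ φ)) ⟨x.unshift μ, μ⟩ else 0)
        - (if (⟨x, μ⟩ : PBond P j) ∈ starB Q then (c : ℂ) * (dN c U Q *ᵥ (mulR h *ᵥ φ)) ⟨x, μ⟩ else 0))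
      = (h x : ℂ) * ((if (⟨x.unshift μ, μ⟩ : PBond P j) ∈ starB Q then
            (c : ℂ) * (starRingEnd ℂ) (cfg U ⟨x.unshift μ, μ⟩) * (dN c U Q *ᵥ φ) ⟨x.unshift μ, μ⟩ else 0)
          - (if (⟨x, μ⟩ : PBond P j) ∈ starB Q then (c : ℂ) * (dN c U Q *ᵥ φ) ⟨x, μ⟩ else 0))
        - ((if (⟨x, μ⟩ : PBond P j) ∈ starB Q then (c : ℂ) * ((h (x.shift μ) : ℂ) - h x) * covD c (cfg U) φ ⟨x, μ⟩ else 0)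
            + (if (⟨x.unshift μ, μ⟩ : PBond P j) ∈ starB Q then
                (c : ℂ) * ((h (x.unshift μ) : ℂ) - h x) * (-(starRingEnd ℂ) (cfg U ⟨x.unshift μ, μ⟩) * covD c (cfg U) φ ⟨x.unshift μ, μ⟩)
              else 0))
        - (c : ℂ) ^ 2 * ((if (⟨x, μ⟩ : PBond P j) ∈ starB Q then ((h (x.shift μ) : ℂ) - h x) else 0)
            + (if (⟨x.unshift μ, μ⟩ : PBond P j) ∈ starB Q then ((h (x.unshift μ) : ℂ) - h x) else 0)) * φ x := by
  rw [dN_mulVec_mulR, dN_mulVec_mulR, dN_mulVec, dN_mulVec]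
  have hu := conj_cfg_mul_cfg U ⟨x.unshift μ, μ⟩
  have et : (⟨x.unshift μ, μ⟩ : PBond P j).tgt = x := shift_unshift x μ
  have et' : (⟨x, μ⟩ : PBond P j).tgt = x.shift μ := rfl
  simp only [et, et']
  unfold covD
  simp only [et, et']
  by_cases h1 : (⟨x.unshift μ, μ⟩ : PBond P j) ∈ starB Q
  · by_cases h2 : (⟨x, μ⟩ : PBond P j) ∈ starB Q
    · simp only [h1, h2, if_true]
      linear_combination (c : ℂ) ^ 2 * ((h x : ℂ) - h (x.unshift μ)) * φ x * hu
    · simp only [h1, h2, if_true, if_false]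
      linear_combination (c : ℂ) ^ 2 * ((h x : ℂ) - h (x.unshift μ)) * φ x * hu
  · by_cases h2 : (⟨x, μ⟩ : PBond P j) ∈ starB Q
    · simp only [h1, h2, if_true, if_false]
      ring
    · simp only [h1, h2, if_false]
      ring

/-- **(2.5) ON THE TORUS**: `(−Δ^N_{u,Q}(hφ))(x) = h(x)(−Δ^N_{u,Q}φ)(x) − Σ_{b∈st(x),b⊂Q}(∂^ηh)(b)(D^η_uφ)(b) − (Δ^{η,N}_Qh)(x)φ(x)`, i.e.
the printed *"(−Δ^{η,N}_{A,Ω}hφ)(x) = (−Δ^ηh)(x)φ(x) − Σ_{b⊂st(x),b⊂Ω}(∂^ηh)(b)(D^η_Aφ)(b) + h(x)(−Δ^{η,N}_{A,Ω}φ)(x)"* for the Gram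
operator `(χ_QD_u)ᴴ(χ_QD_u)` of the torus of record, EVERY `U(1)` field, every real `h`, every `Q`. [cite: Balaban1983RegularityDecay, (2.5) p.576] -/
theorem gram_dN_mulVec_mulR (c : ℝ) (U : GaugeField P j U1) (Q : Finset (Balaban1983to89.Site P j))
    (h : Balaban1983to89.Site P j → ℝ) (φ : Balaban1983to89.Site P j → ℂ) (x : Balaban1983to89.Site P j) :
    (((dN c U Q)ᴴ * dN c U Q) *ᵥ (mulR h *ᵥ φ)) x
      = (h x : ℂ) * (((dN c U Q)ᴴ * dN c U Q) *ᵥ φ) x - gradTerm c U Q h φ x - (lapNh c Q h x : ℂ) * φ x := by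
  rw [← mulVec_mulVec, ← mulVec_mulVec, dN_conjTranspose_mulVec, dN_conjTranspose_mulVec, lapNh_cast]
  unfold gradTerm
  rw [Finset.sum_congr rfl fun μ _ => dir_identity c U Q h φ x μ, Finset.sum_sub_distrib, Finset.sum_sub_distrib, ← Finset.mul_sum,
    ← Finset.sum_mul, ← Finset.mul_sum]

end Leibniz

/-! ## §4 (2.8) and the three-term form (2.10) of `K_i` -/

section Commutator

/-- kernel: `((Q_k|_Q)ᴴ(Q_k|_Q)ψ)(x) = [B^k(x_k) ⊆ Q]·L^{−2kd}·conj(u(Γ^{(k)}_{x_k,x}))·Σ_{x′∈B^k(x_k)} u(Γ^{(k)}_{x_k,x′})ψ(x′)` — the Gram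
operator of the block average couples `x` exactly to its own `k`-block. [cite: Balaban1983RegularityDecay, (2.8) p.576] -/
theorem gram_qMatK_mulVec (U : GaugeField P j U1) (k : ℕ) (Q : Finset (Balaban1983to89.Site P j))
    (ψ : Balaban1983to89.Site P j → ℂ) (x : Balaban1983to89.Site P j) :
    (((qMatK U k Q)ᴴ * qMatK U k Q) *ᵥ ψ) x
      = if blockK k (blkIter k x) ⊆ Q then
          ((P.L : ℂ) ^ (k * P.d))⁻¹ * ((P.L : ℂ) ^ (k * P.d))⁻¹ * (starRingEnd ℂ) (holCK U k x)
            * ∑ x' ∈ blockK k (blkIter k x), holCK U k x' * ψ x'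
        else 0 := by
  rw [← mulVec_mulVec, qMatK_conjTranspose_mulVec, qMatK_mulVec_eq_sum]
  split_ifs with hB
  · ring
  · rfl

/-- **(2.8) ON THE TORUS** (the Leibniz rule of the block average `P_k(A)hφ = hP_k(A)φ + R_k(A, ∂^ηh)φ`, composed with `(Q_k|_Q)ᴴ`):
`a·( h(x)((Q_k|_Q)ᴴQ_k|_Qφ)(x) − ((Q_k|_Q)ᴴQ_k|_Q(hφ))(x) ) = −blockTerm`, EVERY `U(1)` field, every real `h`, every `Q`.
[cite: Balaban1983RegularityDecay, (2.8) p.576] -/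
theorem gram_qMatK_comm_mulR (U : GaugeField P j U1) (k : ℕ) (Q : Finset (Balaban1983to89.Site P j)) (h : Balaban1983to89.Site P j → ℝ)
    (a : ℝ) (φ : Balaban1983to89.Site P j → ℂ) (x : Balaban1983to89.Site P j) :
    (a : ℂ) * ((h x : ℂ) * (((qMatK U k Q)ᴴ * qMatK U k Q) *ᵥ φ) x - (((qMatK U k Q)ᴴ * qMatK U k Q) *ᵥ (mulR h *ᵥ φ)) x)
      = -blockTerm U Q h a k φ x := by
  rw [gram_qMatK_mulVec, gram_qMatK_mulVec]
  unfold blockTerm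
  split_ifs with hB
  · have e : ∑ x' ∈ blockK k (blkIter k x), holCK U k x' * (((h x' : ℂ) - h x) * φ x')
        = ∑ x' ∈ blockK k (blkIter k x), holCK U k x' * (mulR h *ᵥ φ) x'
          - (h x : ℂ) * ∑ x' ∈ blockK k (blkIter k x), holCK U k x' * φ x' := by
      rw [Finset.mul_sum, ← Finset.sum_sub_distrib]
      exact Finset.sum_congr rfl fun x' _ => by rw [mulR_mulVec]; ring
    rw [e]; ring
  · simp

/-- **(2.10) ON THE TORUS — THE THREE-TERM FORM OF `K_i = h_iH_{Q_i}(u) − H_{Q_i}(u)h_i`** (gen 25's `kLet`, the commutator of the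
cut-off `h_i` with the Neumann operator `−Δ^N_{u,Q_i} + a(Q_k|_{Q_i})ᴴQ_k|_{Q_i}` of record):
`(K_iφ)(x) = Σ_{b∈st(x), b⊂Q_i}(∂^ηh_i)(b)(D^η_uφ)(b) + (Δ^{η,N}_{Q_i}h_i)(x)φ(x) − a·L^{−2kd}·conj(u(Γ_{x_k,x}))·Σ_{x′∈B^k(x_k)}
u(Γ_{x_k,x′})(h_i(x′) − h_i(x))φ(x′)` — the printed *"(K_jφ)(x) = 1_{□_j}(x)[ Σ_{b∈st(x)}(∂^ηh_j)(b)(D^η_{Ã_j}φ)(b) + (Δ^ηh_j)(x)φ(x)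
− Σ_{x′∈B^k(y^k(x))} η^d(∂^ηh_j)(Γ^{(k)}_{x,y^k(x),x′})U(Ã_j(Γ^{(k)}_{x,y^k(x),x′}))φ(x′) ]"*, for EVERY `U(1)` field (no smallness), every real
family `h`, every family of regions `Q`, every `a, c, k`; the indicator `1_{□_j}` is automatic (all three terms vanish unless `x ∈ Q_i`).
The print writes the FULL `Δ^ηh_j` and `Σ_{b∈st(x)}` in (2.10), having used (2.6) (the normal derivative of `h_j` vanishes at `∂□_j`); the
Neumann-cut `gradTerm`/`lapNh` here are exact for EVERY `h` and coincide with the printed terms under (2.6).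
[cite: Balaban1983RegularityDecay, (2.10) p.576] -/
theorem kLet_mulVec {J : Type*} (a c : ℝ) (U : GaugeField P j U1) (k : ℕ) (Q : J → Finset (Balaban1983to89.Site P j))
    (h : J → Balaban1983to89.Site P j → ℝ) (i : J) (φ : Balaban1983to89.Site P j → ℂ) (x : Balaban1983to89.Site P j) :
    (kLet a c U k Q h i *ᵥ φ) x
      = gradTerm c U (Q i) (h i) φ x + (lapNh c (Q i) (h i) x : ℂ) * φ x - blockTerm U (Q i) (h i) a k φ x := by
  unfold kLet
  rw [Matrix.sub_mulVec, Pi.sub_apply, ← mulVec_mulVec, ← mulVec_mulVec, mulR_mulVec, nOp_eq]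
  simp only [Matrix.add_mulVec, Pi.add_apply, Matrix.smul_mulVec, Pi.smul_apply, smul_eq_mul]
  rw [gram_dN_mulVec_mulR]
  have hb := gram_qMatK_comm_mulR U k (Q i) (h i) a φ x
  linear_combination hb

/-- (2.10) with all three terms off `Q_i`: `(K_iφ)(x) = 0` for `x ∉ Q_i`. [cite: Balaban1983RegularityDecay, (2.10) p.576] -/
theorem kLet_mulVec_eq_zero_of_not_mem {J : Type*} (a c : ℝ) (U : GaugeField P j U1) (k : ℕ) (Q : J → Finset (Balaban1983to89.Site P j))
    (h : J → Balaban1983to89.Site P j → ℝ) (i : J) (φ : Balaban1983to89.Site P j → ℂ) {x : Balaban1983to89.Site P j} (hx : x ∉ Q i) :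
    (kLet a c U k Q h i *ᵥ φ) x = 0 := by
  rw [kLet_mulVec]
  have h1 : ∀ μ : Fin P.d, (⟨x, μ⟩ : PBond P j) ∉ starB (Q i) := fun μ hb => hx ((mem_starB _ _).1 hb).1
  have h2 : ∀ μ : Fin P.d, (⟨x.unshift μ, μ⟩ : PBond P j) ∉ starB (Q i) := fun μ hb => hx (by
    have := ((mem_starB _ _).1 hb).2
    rwa [show (⟨x.unshift μ, μ⟩ : PBond P j).tgt = x from shift_unshift x μ] at this)
  have h3 : ¬ blockK k (blkIter k x) ⊆ Q i := fun hB => hx (hB (mem_blockK_blkIter k x))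
  unfold gradTerm lapNh blockTerm
  simp [h1, h2, h3]

end Commutator

/-! ## §5 Where the three terms live and how large they are (the inputs of the smallness of `R`, p. 577 l. 1–2) -/

section Bounds

/-- `|u_b| = 1`. [cite: BalabanImbrieJaffe1988, (1.1) p.258] -/
private theorem norm_cfg (U : GaugeField P j U1) (b : PBond P j) : ‖cfg U b‖ = 1 := by
  unfold cfg; exact norm_toC _

/-- kernel: `|r − s|` read through `ℂ`. [cite: Balaban1983RegularityDecay, (2.10) p.576] -/
private theorem norm_ofReal_sub (r s : ℝ) : ‖((r : ℂ) - s)‖ = |r - s| := by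
  rw [← Complex.ofReal_sub, Complex.norm_real, Real.norm_eq_abs]

/-- **THE GRADIENT TERM IS FIRST ORDER IN `∂^ηh`**: `|Σ_{b∈st(x),b⊂Q}(∂^ηh)(b)(D^η_uφ)(b)| ≤ |c|·Σ_μ( |h(x+e_μ) − h(x)|·|(D_uφ)(⟨x,x+e_μ⟩)|
+ |h(x−e_μ) − h(x)|·|(D_uφ)(⟨x−e_μ,x⟩)| )` (`|u_b| = 1`) — the `|∂^ηh_j| = O(M⁻¹)` entry of the printed *"R is a small operator in
reasonable norms because |∂^ηh_j| ≦ O(M⁻¹), |Δ^ηh_j| ≦ O(M⁻²)"*. [cite: Balaban1983RegularityDecay, (2.10) p.576] -/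
theorem norm_gradTerm_le (c : ℝ) (U : GaugeField P j U1) (Q : Finset (Balaban1983to89.Site P j)) (h : Balaban1983to89.Site P j → ℝ)
    (φ : Balaban1983to89.Site P j → ℂ) (x : Balaban1983to89.Site P j) :
    ‖gradTerm c U Q h φ x‖
      ≤ |c| * ∑ μ : Fin P.d, (|h (x.shift μ) - h x| * ‖covD c (cfg U) φ ⟨x, μ⟩‖
          + |h (x.unshift μ) - h x| * ‖covD c (cfg U) φ ⟨x.unshift μ, μ⟩‖) := by
  unfold gradTerm
  rw [Finset.mul_sum]
  refine (norm_sum_le _ _).trans (Finset.sum_le_sum fun μ _ => (norm_add_le _ _).trans ?_)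
  rw [mul_add]
  refine add_le_add ?_ ?_
  · split_ifs
    · rw [norm_mul, norm_mul, Complex.norm_real, Real.norm_eq_abs, norm_ofReal_sub, mul_assoc]
    · rw [norm_zero]; positivity
  · split_ifs
    · rw [norm_mul, norm_mul, norm_mul, norm_neg, Complex.norm_conj, norm_cfg, one_mul, Complex.norm_real, Real.norm_eq_abs,
        norm_ofReal_sub, mul_assoc]
    · rw [norm_zero]; positivity

/-- **THE LAPLACIAN TERM IS A SUM OF `2d` FIRST DIFFERENCES** (crude form): `|(Δ^{η,N}_Qh)(x)| ≤ c²·Σ_μ(|h(x+e_μ) − h(x)| + |h(x−e_μ) − h(x)|)`.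
[cite: Balaban1983RegularityDecay, (2.10) p.576] -/
theorem abs_lapNh_le (c : ℝ) (Q : Finset (Balaban1983to89.Site P j)) (h : Balaban1983to89.Site P j → ℝ) (x : Balaban1983to89.Site P j) :
    |lapNh c Q h x| ≤ c ^ 2 * ∑ μ : Fin P.d, (|h (x.shift μ) - h x| + |h (x.unshift μ) - h x|) := by
  unfold lapNh
  rw [abs_mul, abs_of_nonneg (sq_nonneg c)]
  refine mul_le_mul_of_nonneg_left ((Finset.abs_sum_le_sum_abs _ _).trans (Finset.sum_le_sum fun μ _ => (abs_add_le _ _).trans ?_))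
    (sq_nonneg c)
  refine add_le_add ?_ ?_ <;> split_ifs <;> simp

/-- **THE LAPLACIAN TERM IN THE INTERIOR IS THE FULL SECOND DIFFERENCE**: when all `2d` bonds at `x` lie in `Q`,
`(Δ^{η,N}_Qh)(x) = c²·Σ_μ (h(x+e_μ) − 2h(x) + h(x−e_μ)) = (Δ^ηh)(x)` — the `|Δ^ηh_j| = O(M⁻²)` entry of p. 577 l. 3 applies there.
[cite: Balaban1983RegularityDecay, (2.10) p.576] -/
theorem lapNh_eq_of_forall_mem {c : ℝ} {Q : Finset (Balaban1983to89.Site P j)} (h : Balaban1983to89.Site P j → ℝ) {x : Balaban1983to89.Site P j}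
    (hQ : ∀ μ : Fin P.d, (⟨x, μ⟩ : PBond P j) ∈ starB Q ∧ (⟨x.unshift μ, μ⟩ : PBond P j) ∈ starB Q) :
    lapNh c Q h x = c ^ 2 * ∑ μ : Fin P.d, (h (x.shift μ) - 2 * h x + h (x.unshift μ)) := by
  unfold lapNh
  congr 1
  refine Finset.sum_congr rfl fun μ _ => ?_
  rw [if_pos (hQ μ).1, if_pos (hQ μ).2]; ring

/-- **THE ONE-SIDED (NEUMANN) LAPLACIAN TERM AT A FACE**: when the forward bond `⟨x, x+e_μ⟩` lies in `Q` but the backward bond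
`⟨x−e_μ, x⟩` does not (a face of `Q` normal to `e_μ` through `x`), direction `μ` contributes the FIRST difference `c²(h(x+e_μ) − h(x))`
only — the boundary term behind the printed *"Special care has to be taken in considering boundary terms"* and (2.6)–(2.7) (it vanishes
iff the normal derivative of `h` vanishes there). [cite: Balaban1983RegularityDecay, (2.6) p.576] -/
theorem lapNh_dir_of_mem_of_not_mem {Q : Finset (Balaban1983to89.Site P j)} (h : Balaban1983to89.Site P j → ℝ)
    {x : Balaban1983to89.Site P j} {μ : Fin P.d} (h1 : (⟨x, μ⟩ : PBond P j) ∈ starB Q) (h2 : (⟨x.unshift μ, μ⟩ : PBond P j) ∉ starB Q) :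
    ((if (⟨x, μ⟩ : PBond P j) ∈ starB Q then (h (x.shift μ) - h x) else 0)
        + (if (⟨x.unshift μ, μ⟩ : PBond P j) ∈ starB Q then (h (x.unshift μ) - h x) else 0))
      = h (x.shift μ) - h x := by
  rw [if_pos h1, if_neg h2, add_zero]

/-- **THE BLOCK TERM IS FIRST ORDER IN `h(x′) − h(x)` OVER ONE `k`-BLOCK**:
`|blockTerm| ≤ |a|·L^{−2kd}·Σ_{x′∈B^k(x_k)} |h(x′) − h(x)|·|φ(x′)|` (`|u(Γ)| = 1`). [cite: Balaban1983RegularityDecay, (2.8) p.576] -/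
theorem norm_blockTerm_le (U : GaugeField P j U1) (Q : Finset (Balaban1983to89.Site P j)) (h : Balaban1983to89.Site P j → ℝ) (a : ℝ) (k : ℕ)
    (φ : Balaban1983to89.Site P j → ℂ) (x : Balaban1983to89.Site P j) :
    ‖blockTerm U Q h a k φ x‖
      ≤ |a| * (((P.L : ℝ) ^ (k * P.d))⁻¹ * ((P.L : ℝ) ^ (k * P.d))⁻¹)
          * ∑ x' ∈ blockK k (blkIter k x), |h x' - h x| * ‖φ x'‖ := by
  unfold blockTerm
  split_ifs
  · rw [norm_mul, norm_mul, norm_mul, Complex.norm_conj, norm_holCK, mul_one, Complex.norm_real, Real.norm_eq_abs, norm_mul, norm_inv,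
      norm_pow, Complex.norm_natCast]
    refine mul_le_mul_of_nonneg_left ((norm_sum_le _ _).trans (Finset.sum_le_sum fun x' _ => ?_)) (by positivity)
    rw [norm_mul, norm_holCK, one_mul, norm_mul, norm_ofReal_sub]
  · rw [norm_zero]; positivity

/-- **`K_i` LIVES WHERE `h_i` VARIES** (operator form of gen 25's kernel statement `kLet_apply_eq_zero_of_eq`): if `h_i` takes the value
`h_i(x)` at the `2d` neighbours of `x` and on the `k`-block of `x`, then `(K_iφ)(x) = 0` for every `φ` — inside the plateau `{h_i = 1}`
and outside `supp h_i` all three terms of (2.10) vanish. [cite: Balaban1983RegularityDecay, (2.10) p.576] -/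
theorem kLet_mulVec_eq_zero_of_forall_eq {J : Type*} (a c : ℝ) (U : GaugeField P j U1) (k : ℕ) (Q : J → Finset (Balaban1983to89.Site P j))
    (h : J → Balaban1983to89.Site P j → ℝ) (i : J) (φ : Balaban1983to89.Site P j → ℂ) {x : Balaban1983to89.Site P j}
    (hnb : ∀ μ : Fin P.d, h i (x.shift μ) = h i x ∧ h i (x.unshift μ) = h i x) (hB : ∀ x' ∈ blockK k (blkIter k x), h i x' = h i x) :
    (kLet a c U k Q h i *ᵥ φ) x = 0 := by
  rw [kLet_mulVec]
  have e1 : gradTerm c U (Q i) (h i) φ x = 0 := by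
    unfold gradTerm
    refine Finset.sum_eq_zero fun μ _ => ?_
    rw [(hnb μ).1, (hnb μ).2, sub_self]; simp
  have e2 : lapNh c (Q i) (h i) x = 0 := by
    unfold lapNh
    rw [Finset.sum_eq_zero fun μ _ => ?_, mul_zero]
    rw [(hnb μ).1, (hnb μ).2, sub_self]; simp
  have e3 : blockTerm U (Q i) (h i) a k φ x = 0 := by
    unfold blockTerm
    split_ifs
    · rw [Finset.sum_eq_zero fun x' hx' => ?_, mul_zero]
      rw [hB x' hx', sub_self, zero_mul, mul_zero]
    · rfl
  rw [e1, e2, e3]; simp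

end Bounds

end

end Literature.MathematicalPhysics.QuantumFieldTheory.BalabanImbrieJaffe1984to88.BIJ88NeumannCommutator210Torus
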